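import Literature.NumberTheory.Automorphic.InducedCharacterInvariantForm          -- ★ generic: `exists_isCompl_subrepresentation_smoothIndRep_of_norm_sq_eq` (BZ76 2.25 (c))
import Literature.NumberTheory.Automorphic.SmoothInductionAdmissibleOfCocompact    -- ★ `isAdmissible_cmPrincipalSeries_of_iwasawa`
import Literature.NumberTheory.Automorphic.UnitaryGroupCMLocalIwasawa              -- ★ `exists_borel_mul_mem_cmLocalIntegralLevel` (`G = B · K_v`, every `N`, every finite `v`)
import Literature.NumberTheory.Automorphic.LocalUnitaryGroupUnimodularIsotropic     -- ★ `isMulRightInvariant_cmDatum_local_antidiagOne` (`U(Φ_N)(L⁺_v)` unimodular)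
import Literature.NumberTheory.Automorphic.LocalUnitaryGroupCongrMeasure            -- ★ `locallyCompactSpace_local`, `secondCountableTopology_local`, `t2Space_cmDatum_local`
import Literature.NumberTheory.Automorphic.UnitaryGroupPrincipalSeriesExponents     -- ★ `cmTorusCharPair` (the PAIR currency of RUNG 0)
import Summits.HodgeConjecture.HodgeConjecture.Theorems.F0P3cStCharTSTorusCompactPart -- ★ `compactSpace_normOneUnits` (`E¹_v` compact at a non-split `v`)
import Mathlib.RepresentationTheory.Semisimple
import HarnessLib

/-!
# F0 · P3c · line LH6 «StCharTS» — «PS-UNITARY★»: the unitary principal series `i_G(χ)` of `U(Φ_N)(L⁺_v)` is COMPLETELY REDUCIBLE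
# (Bernstein–Zelevinsky 1976, 2.25 (c); Cartier 1979, Thm. 3.2 (c); Casselman 1995, Prop. 2.1.5, §3.1; Rogawski 1990, §12.1–§12.2)

Cell `pub/hodgecm-mathlib`, crux H413 = `stmt-HodgeConjecture-24833` (lane `--supports … --as helper`), route HCCMUnconditional; seat F0P2-p06 (g19),
DEFAULT brick «LDS-RED-TWO ⟸ KEYS-RED-(3)» FILE 1 (census correction to `F0/P3b/LH6-p02/g7/CENSUS-hLdsTwo.v1.LH6p02g7.md` §(U): the Iwasawa
decomposition `U(Φ_N)(L⁺_v) = B · K_v` IS in the tree, ★ `UnitaryGroup.exists_borel_mul_mem_cmLocalIntegralLevel`, so (U) is a transport, not a road).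
THEOREMS ONLY (no definition ∕ instance ∕ notation ∕ named fact ∕ `sorry`); ★-only imports.

WHAT.  `G = U(Φ_N)(L⁺_v) = ↥(unitaryGroupOfForm (conjLocal L c v) (cmLocalForm L N v))` (every `N`, every finite place `v` of `L⁺`), `B` its upper
triangular Borel subgroup (★ `cmBorelTriple`), `χ : T → ℂˣ` a character of the diagonal torus with `|χ| = 1`, `i_G(χ)` = ★ `cmPrincipalSeries L N v χ`
(normalised smooth induction `Ind_B^G(χ δ_B^{1/2})`).
* §1 **`isSemisimpleRepresentation_cmPrincipalSeries`** — `i_G(χ)` is a SEMISIMPLE representation (Mathlib `Representation.IsSemisimpleRepresentation`: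
  every subrepresentation has an invariant complement).  Proof = the tree's generic ★ `exists_isCompl_subrepresentation_smoothIndRep_of_norm_sq_eq`
  (the `G`-invariant positive definite Hermitian form `∫_{K_v} conj(f₁) f₂`, [BernsteinZelevinsky1976, 2.25 (c)]) at `H = B` (closed, ★ `isClosed_borelU`),
  `K = K_v = U(Φ_N)(𝒪_v)` (compact open, ★ `isCompact_isOpen_cmLocalIntegralLevel`), `G = B · K_v` (★ `exists_borel_mul_mem_cmLocalIntegralLevel`),
  `G` unimodular (★ `isMulRightInvariant_cmDatum_local_antidiagOne`), `|χ(proj p) δ_B^{1/2}(p)|² = Δ_B(p)` (`|χ| = 1`, ★ `rootDeltaChar_apply`), and admissibility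
  ★ `isAdmissible_cmPrincipalSeries_of_iwasawa` (no continuity hypothesis on `χ` is needed).
* §2 The PAIR currency of RUNG 0 (`N = 3`, `χ = (χ₁, χ₂)` = ★ `cmTorusCharPair L v χ₁ χ₂`, `v` NON-SPLIT): **`norm_apply_eq_one_of_apply_fixed_eq_one`** — a
  CONTINUOUS `χ₁ : E_vˣ → ℂˣ` trivial on the `σ`-fixed units (`χ₁|_{F_v^×} = 1`, the semi-regular condition of [Rogawski1990, §12.2 (3)]) is UNITARY
  (`|χ₁(σx)| = |χ₁ x|⁻¹` as `x·σx` is `σ`-fixed, and `= |χ₁ x|` as `σx·x⁻¹ ∈ E¹_v`, compact ★ `compactSpace_normOneUnits`); **`norm_apply_normOneUnits_eq_one`** —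
  a continuous `χ₂ : E¹_v → ℂˣ` is unitary; hence **`norm_cmTorusCharPair_eq_one`** and **`isSemisimpleRepresentation_cmPrincipalSeries_cmTorusCharPair`**:
  `i_G(χ₁, χ₂)` is semisimple whenever `χ₁, χ₂` are continuous and `χ₁|_{F_v^×} = 1`.
CONSUMER: FILE 2 `Theorems/F0P3cStCharTSLdsRedTwoOfReducible.lean` («the two constituents of a reducible semi-regular `i_G(χ)` are non-isomorphic» ⟸ §2 +
Frobenius ★ + N1 ★), which re-letters RUNG 0's named input `hLdsRedTwo` (★ `F0P3cStCharTSRung0Five` :129) to Keys' reducibility statement ALONE.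
HONEST LABEL: HC_CM is proved only modulo the 7 printed citations (2 remaining named inputs: hLiu418 = `stmt-HodgeConjecture-24832`, h413 =
`stmt-HodgeConjecture-24833`) until rung 0 closes; this file closes no organ and removes no print (count-neutral helper).

## References
* [BernsteinZelevinsky1976] I. N. Bernstein, A. V. Zelevinsky, *Representations of the group GL(n, F) where F is a non-archimedean local field*, Russian
  Math. Surveys 31:3 (1976), 1.21, 2.25 (c) («if `π` is unitary then so is `ind(π δ^{1/2})`»).
* [Cartier1979] P. Cartier, *Representations of p-adic groups: a survey*, PSPM 33.1 (1979), §III.3.3 Thm. 3.2 (c), (8)–(11) p. 136; §1.5.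
* [Casselman1995] W. Casselman, *Introduction to the theory of admissible representations of p-adic reductive groups* (1995), Prop. 2.1.5, §3.1.
* [Rogawski1990] J. D. Rogawski, *Automorphic Representations of Unitary Groups in Three Variables*, Ann. of Math. Stud. 123 (1990), §4.5 p. 45 (`G = BK`),
  §12.1 p. 171, §12.2 pp. 173–174.
* [Bump1997] D. Bump, *Automorphic Forms and Representations* (1997), Prop. 4.2.5.
-/

set_option autoImplicit false
-- the mandated namespace has the single-problem summit's repeated segment (`HodgeConjecture.HodgeConjecture`)
set_option linter.dupNamespace false

noncomputable section

open NumberField IsDedekindDomain MeasureTheory MeasureTheory.Measure Topology Filter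
open scoped NNReal ComplexConjugate
open Literature.NumberTheory.Automorphic Literature.NumberTheory.Automorphic.UnitaryGroup

namespace Summit.HodgeConjecture.HodgeConjecture.Cruxes.H413.F0P3cStCharTSPrincipalSeriesUnitary

/-! ## §1 `i_G(χ)` is completely reducible for `|χ| = 1` (every `N`, every finite place `v`) -/

section AnyRank

variable (L : Type) [Field L] [NumberField L] [IsCMField L] (N : ℕ) (v : HeightOneSpectrum (𝓞 ↥(maximalRealSubfield L)))

set_option maxHeartbeats 1600000 in
set_option synthInstance.maxHeartbeats 400000 in
/-- **«PS-UNITARY★» — the unitary principal series of `U(Φ_N)(L⁺_v)` is completely reducible.**  For EVERY character `χ` of the diagonal torus with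
`|χ| = 1`, ★ `cmPrincipalSeries L N v χ = Ind_B^G(χ δ_B^{1/2})` is a semisimple representation: every subrepresentation has an invariant complement
(the orthogonal complement for the `G`-invariant inner product `∫_{K_v} conj(f₁) f₂`, `G = B · K_v`).  Transport of the tree's generic ★
`exists_isCompl_subrepresentation_smoothIndRep_of_norm_sq_eq` to the CM carrier.
[cite: BernsteinZelevinsky1976, 2.25 (c)] [cite: Cartier1979, §III.3.3 Thm. 3.2 (c) p. 136] [cite: Rogawski1990, §4.5 p. 45; §12.2 p. 173] -/
theorem isSemisimpleRepresentation_cmPrincipalSeries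
    (χ : ↥(torusU (conjLocal L (IsCMField.complexConj L) v) (cmLocalForm L N v)) →* ℂˣ) (hχu : ∀ t, ‖((χ t : ℂˣ) : ℂ)‖ = 1) :
    (cmPrincipalSeries L N v χ).IsSemisimpleRepresentation := by
  classical
  haveI := locallyCompactSpace_cmBorelU L N v
  -- point-set and measure-theoretic structure on `G = U(Φ_N)(L⁺_v)`
  haveI : LocallyCompactSpace ↥(unitaryGroupOfForm (conjLocal L (IsCMField.complexConj L) v) (cmLocalForm L N v)) :=
    locallyCompactSpace_local (IsCMField.complexConj L) N _ v
  haveI : SecondCountableTopology ↥(unitaryGroupOfForm (conjLocal L (IsCMField.complexConj L) v) (cmLocalForm L N v)) :=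
    secondCountableTopology_local (IsCMField.complexConj L) N _ v
  haveI : T2Space ↥(unitaryGroupOfForm (conjLocal L (IsCMField.complexConj L) v) (cmLocalForm L N v)) :=
    t2Space_cmDatum_local N L (Matrix.of fun i j : Fin N => if i.val + j.val + 1 = N then (1 : L) else 0) v
  letI mG : MeasurableSpace ↥(unitaryGroupOfForm (conjLocal L (IsCMField.complexConj L) v) (cmLocalForm L N v)) := borel _
  haveI bG : BorelSpace ↥(unitaryGroupOfForm (conjLocal L (IsCMField.complexConj L) v) (cmLocalForm L N v)) := ⟨rfl⟩
  haveI : T1Space (LocalRing L v) := inferInstance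
  have hBcl : IsClosed ((cmBorelTriple L N v).P : Set ↥(unitaryGroupOfForm (conjLocal L (IsCMField.complexConj L) v) (cmLocalForm L N v))) :=
    isClosed_borelU (conjLocal L (IsCMField.complexConj L) v) (cmLocalForm L N v)
  -- Iwasawa `G = B · K_v`, `K_v` compact open (the level `cmLocalIntegralLevel`, read as a subgroup of THIS carrier — `cmDatum_Local_eq` is `rfl`)
  set K₀ : Subgroup ↥(unitaryGroupOfForm (conjLocal L (IsCMField.complexConj L) v) (cmLocalForm L N v)) :=
    cmLocalIntegralLevel L N (Matrix.of fun i j : Fin N => if i.val + j.val + 1 = N then (1 : L) else 0) v with hK₀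
  have hK : IsCompact (K₀ : Set ↥(unitaryGroupOfForm (conjLocal L (IsCMField.complexConj L) v) (cmLocalForm L N v))) ∧
      IsOpen (K₀ : Set ↥(unitaryGroupOfForm (conjLocal L (IsCMField.complexConj L) v) (cmLocalForm L N v))) :=
    isCompact_isOpen_cmLocalIntegralLevel L N (Matrix.of fun i j : Fin N => if i.val + j.val + 1 = N then (1 : L) else 0) v
  have hBK : ∀ g : ↥(unitaryGroupOfForm (conjLocal L (IsCMField.complexConj L) v) (cmLocalForm L N v)),
      ∃ p ∈ (cmBorelTriple L N v).P, ∃ k ∈ K₀, g = p * k := fun g => by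
    obtain ⟨h, κ, hκ, hg⟩ := exists_borel_mul_mem_cmLocalIntegralLevel L N v g
    exact ⟨h, h.2, κ, hκ, hg⟩
  -- Haar measure on the unimodular `G`
  set μG : Measure ↥(unitaryGroupOfForm (conjLocal L (IsCMField.complexConj L) v) (cmLocalForm L N v)) := Measure.haar with hμG
  have hμG : μG.IsHaarMeasure := inferInstance
  haveI : μG.IsMulRightInvariant :=
    @isMulRightInvariant_cmDatum_local_antidiagOne L _ _ _ N v mG bG μG hμG
  -- the inducing character `σ = χ(proj ·) δ_B^{1/2}` and `|σ(p)|² = Δ_B(p)`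
  set σP : Representation ℂ ↥(cmBorelTriple L N v).P ℂ :=
    Representation.twist (((Representation.trivial ℂ ↥(torusU (conjLocal L (IsCMField.complexConj L) v) (cmLocalForm L N v)) ℂ).twist χ).comp
      (cmBorelTriple L N v).proj) (rootDeltaChar (cmBorelTriple L N v).P) with hσP
  have hπ : cmPrincipalSeries L N v χ = Representation.smoothIndRep (cmBorelTriple L N v).P σP := rfl
  have hτ : ∀ p : ↥(cmBorelTriple L N v).P,
      σP p 1 = ((χ ((cmBorelTriple L N v).proj p) : ℂˣ) : ℂ) * ((rootDeltaChar (cmBorelTriple L N v).P p : ℂˣ) : ℂ) := by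
    intro p
    simp only [hσP, Representation.twist_apply, MonoidHom.comp_apply, Representation.trivial_apply, smul_eq_mul, mul_one]
    ring
  have hσ : ∀ p : ↥(cmBorelTriple L N v).P, ‖σP p 1‖ ^ 2 = ((modularCharacter p : ℝ≥0) : ℝ) := by
    intro p
    rw [hτ p, norm_mul, hχu, one_mul, rootDeltaChar_apply, Complex.norm_real, Real.norm_of_nonneg (NNReal.coe_nonneg _),
      ← NNReal.coe_pow, NNReal.sq_sqrt]
  -- admissibility (Iwasawa, no continuity needed) and the generic complete-reducibility theorem
  have hadm : (Representation.smoothIndRep (cmBorelTriple L N v).P σP).IsAdmissible := by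
    rw [← hπ]; exact isAdmissible_cmPrincipalSeries_of_iwasawa L N v (exists_borel_mul_mem_cmLocalIntegralLevel L N v) χ
  have hcompl : ∀ W : Subrepresentation (Representation.smoothIndRep (cmBorelTriple L N v).P σP),
      ∃ W' : Subrepresentation (Representation.smoothIndRep (cmBorelTriple L N v).P σP), IsCompl W.toSubmodule W'.toSubmodule :=
    fun W => exists_isCompl_subrepresentation_smoothIndRep_of_norm_sq_eq
      (G := ↥(unitaryGroupOfForm (conjLocal L (IsCMField.complexConj L) v) (cmLocalForm L N v)))
      (H := (cmBorelTriple L N v).P) (K := K₀) σP hBcl hK.2 hK.1 hBK μG hσ hadm W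
  rw [hπ]
  refine ⟨fun W => ?_⟩
  obtain ⟨W', hc⟩ := hcompl W
  refine ⟨W', ?_, ?_⟩
  · rw [disjoint_iff]
    apply Subrepresentation.toSubmodule_injective
    exact disjoint_iff.1 hc.1
  · rw [codisjoint_iff]
    apply Subrepresentation.toSubmodule_injective
    exact codisjoint_iff.1 hc.2

end AnyRank

/-! ## §2 The pair currency at a non-split place: `χ = (χ₁, χ₂)` with `χ₁|_{F_v^×} = 1` is unitary, so `i_G(χ₁, χ₂)` is completely reducible -/

section Pair

variable (L : Type) [Field L] [NumberField L] [IsCMField L] (v : HeightOneSpectrum (𝓞 ↥(maximalRealSubfield L)))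
  (hns : ∀ w : PlacesOver L v, IsCMField.complexConj L • w.1 = w.1)

include hns in
/-- **A continuous character of the compact `E¹_v` is unitary** (`v` non-split: `E¹_v` is compact, ★ `compactSpace_normOneUnits`; the norms of the values of a
continuous character of a compact group form a bounded subgroup of `ℝ_{>0}`, hence are `1`). [cite: Rogawski1990, §12.1 p. 171] -/
theorem norm_apply_normOneUnits_eq_one (χ₂ : ↥(normOneUnits (conjLocal L (IsCMField.complexConj L) v)) →* ℂˣ)
    (h2 : Continuous fun x => ((χ₂ x : ℂˣ) : ℂ)) (b : ↥(normOneUnits (conjLocal L (IsCMField.complexConj L) v))) :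
    ‖((χ₂ b : ℂˣ) : ℂ)‖ = 1 := by
  haveI := F0P3cStCharTSTorusCompactPart.compactSpace_normOneUnits L v hns
  have hc : Continuous fun τ : ↥(normOneUnits (conjLocal L (IsCMField.complexConj L) v)) => ‖((χ₂ τ : ℂˣ) : ℂ)‖ := continuous_norm.comp h2
  obtain ⟨M, hM⟩ := (isCompact_range hc).isBounded.bddAbove
  have hle : ∀ τ : ↥(normOneUnits (conjLocal L (IsCMField.complexConj L) v)), ‖((χ₂ τ : ℂˣ) : ℂ)‖ ≤ 1 := fun τ => not_lt.mp fun hlt => by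
    obtain ⟨m, hm⟩ := pow_unbounded_of_one_lt M hlt
    have hm' : ‖((χ₂ τ : ℂˣ) : ℂ)‖ ^ m ≤ M := by
      have := hM (Set.mem_range_self (τ ^ m))
      simpa only [map_pow, Units.val_pow_eq_pow_val, norm_pow] using this
    exact absurd hm' (not_le.mpr hm)
  refine le_antisymm (hle b) ?_
  have h1 := hle b⁻¹
  rw [map_inv, Units.val_inv_eq_inv_val, norm_inv] at h1
  exact (inv_le_one₀ (norm_pos_iff.mpr (Units.ne_zero _))).mp h1

include hns in
/-- **A continuous character `χ₁` of `E_v^×` with `χ₁|_{F_v^×} = 1` is unitary** (`v` non-split).  For a unit `x`, `x · σ(x)` is `σ`-fixed, so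
`χ₁(σ x) = χ₁(x)⁻¹`; and `u := σ(x) · x⁻¹` lies in the compact `E¹_v` (`σ(u) u = 1`), on which `|χ₁| = 1` (`norm_apply_normOneUnits_eq_one`), so `|χ₁(σ x)| = |χ₁(x)|`;
together `|χ₁(x)|² = 1`.  (The semi-regular characters of [Rogawski1990, §12.2 (3)] are unitary.) [cite: Rogawski1990, §12.2 (3) p. 173] -/
theorem norm_apply_eq_one_of_apply_fixed_eq_one (χ₁ : (LocalRing L v)ˣ →* ℂˣ) (h1 : Continuous fun x => ((χ₁ x : ℂˣ) : ℂ))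
    (htriv : ∀ a : (LocalRing L v)ˣ, (conjLocal L (IsCMField.complexConj L) v) (a : LocalRing L v) = a → χ₁ a = 1) (x : (LocalRing L v)ˣ) :
    ‖((χ₁ x : ℂˣ) : ℂ)‖ = 1 := by
  -- `σ` on units
  set σu : (LocalRing L v)ˣ →* (LocalRing L v)ˣ := Units.map (conjLocal L (IsCMField.complexConj L) v).toMonoidHom with hσu
  have hσu_coe : ∀ y : (LocalRing L v)ˣ, ((σu y : (LocalRing L v)ˣ) : LocalRing L v) = conjLocal L (IsCMField.complexConj L) v (y : LocalRing L v) :=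
    fun y => rfl
  have hσσ : ∀ y : LocalRing L v, conjLocal L (IsCMField.complexConj L) v (conjLocal L (IsCMField.complexConj L) v y) = y :=
    conjLocal_conjLocal_cm L v
  -- `σ` is an involution on units
  have hσuσu : σu (σu x) = x := Units.ext (by rw [hσu_coe, hσu_coe, hσσ])
  -- (a) `χ₁(σ x) = χ₁(x)⁻¹`: `x · σ x` is `σ`-fixed
  have hfix : conjLocal L (IsCMField.complexConj L) v ((x * σu x : (LocalRing L v)ˣ) : LocalRing L v) = (x * σu x : (LocalRing L v)ˣ) := by
    rw [← hσu_coe, map_mul, hσuσu, mul_comm]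
  have ha : χ₁ (σu x) = (χ₁ x)⁻¹ := by
    have h := htriv (x * σu x) hfix
    rw [map_mul] at h
    exact eq_inv_of_mul_eq_one_right h
  -- (b) `|χ₁(σ x)| = |χ₁ x|`: `σ x · x⁻¹ ∈ E¹_v`
  have hmem : σu x * x⁻¹ ∈ normOneUnits (conjLocal L (IsCMField.complexConj L) v) := by
    rw [mem_normOneUnits_iff, ← hσu_coe, ← Units.val_mul, map_mul, map_inv, hσuσu,
      show x * (σu x)⁻¹ * (σu x * x⁻¹) = 1 by group, Units.val_one]
  have hb : ‖((χ₁ (σu x) : ℂˣ) : ℂ)‖ = ‖((χ₁ x : ℂˣ) : ℂ)‖ := by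
    have hres : Continuous fun b : ↥(normOneUnits (conjLocal L (IsCMField.complexConj L) v)) =>
        (((χ₁.comp (normOneUnits (conjLocal L (IsCMField.complexConj L) v)).subtype) b : ℂˣ) : ℂ) :=
      h1.comp continuous_subtype_val
    have hu := norm_apply_normOneUnits_eq_one L v hns (χ₁.comp (normOneUnits (conjLocal L (IsCMField.complexConj L) v)).subtype) hres ⟨_, hmem⟩
    simp only [MonoidHom.comp_apply, Subgroup.subtype_apply, map_mul, map_inv, Units.val_mul, Units.val_inv_eq_inv_val, norm_mul, norm_inv] at hu
    have hx0 : ‖((χ₁ x : ℂˣ) : ℂ)‖ ≠ 0 := norm_ne_zero_iff.2 (χ₁ x).ne_zero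
    exact (mul_inv_eq_one₀ hx0).1 hu
  -- (c) conclude: `|χ₁ x|⁻¹ = |χ₁ x|` with `|χ₁ x| > 0`
  rw [ha, Units.val_inv_eq_inv_val, norm_inv] at hb
  have hpos : 0 < ‖((χ₁ x : ℂˣ) : ℂ)‖ := norm_pos_iff.2 (χ₁ x).ne_zero
  have hsq : ‖((χ₁ x : ℂˣ) : ℂ)‖ * ‖((χ₁ x : ℂˣ) : ℂ)‖ = 1 := by
    nth_rewrite 1 [← hb]
    exact inv_mul_cancel₀ hpos.ne'
  nlinarith [hpos, hsq]

include hns in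
/-- **`|χ(t)| = 1` for `χ = (χ₁, χ₂)`** (★ `cmTorusCharPair L v χ₁ χ₂ : d ↦ χ₁(d₀) χ₂(det d)`) with `χ₁, χ₂` continuous and `χ₁|_{F_v^×} = 1`, `v` non-split.
[cite: Rogawski1990, §12.1 p. 171; §12.2 (3) p. 173] -/
theorem norm_cmTorusCharPair_eq_one (χ₁ : (LocalRing L v)ˣ →* ℂˣ) (χ₂ : ↥(normOneUnits (conjLocal L (IsCMField.complexConj L) v)) →* ℂˣ)
    (h1 : Continuous fun x => ((χ₁ x : ℂˣ) : ℂ)) (h2 : Continuous fun x => ((χ₂ x : ℂˣ) : ℂ))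
    (htriv : ∀ a : (LocalRing L v)ˣ, (conjLocal L (IsCMField.complexConj L) v) (a : LocalRing L v) = a → χ₁ a = 1)
    (t : ↥(torusU (conjLocal L (IsCMField.complexConj L) v) (cmLocalForm L 3 v))) :
    ‖((cmTorusCharPair L v χ₁ χ₂ t : ℂˣ) : ℂ)‖ = 1 := by
  rw [cmTorusCharPair, torusCharPair_apply, Units.val_mul, norm_mul, norm_apply_eq_one_of_apply_fixed_eq_one L v hns χ₁ h1 htriv,
    norm_apply_normOneUnits_eq_one L v hns χ₂ h2, one_mul]

include hns in
/-- **`i_G(χ₁, χ₂)` is completely reducible at the semi-regular unitary characters** (`χ₁, χ₂` continuous, `χ₁|_{F_v^×} = 1`, `v` non-split) — the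
representation of RUNG 0's named inputs `hKeysRed` ∕ `hLdsRedTwo` (★ `F0P3cStCharTSRung0Five`).  [cite: BernsteinZelevinsky1976, 2.25 (c)]
[cite: Rogawski1990, §12.2 (3) pp. 173–174] -/
theorem isSemisimpleRepresentation_cmPrincipalSeries_cmTorusCharPair
    (χ₁ : (LocalRing L v)ˣ →* ℂˣ) (χ₂ : ↥(normOneUnits (conjLocal L (IsCMField.complexConj L) v)) →* ℂˣ)
    (h1 : Continuous fun x => ((χ₁ x : ℂˣ) : ℂ)) (h2 : Continuous fun x => ((χ₂ x : ℂˣ) : ℂ))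
    (htriv : ∀ a : (LocalRing L v)ˣ, (conjLocal L (IsCMField.complexConj L) v) (a : LocalRing L v) = a → χ₁ a = 1) :
    (cmPrincipalSeries L 3 v (cmTorusCharPair L v χ₁ χ₂)).IsSemisimpleRepresentation :=
  isSemisimpleRepresentation_cmPrincipalSeries L 3 v (cmTorusCharPair L v χ₁ χ₂) (norm_cmTorusCharPair_eq_one L v hns χ₁ χ₂ h1 h2 htriv)

end Pair

end Summit.HodgeConjecture.HodgeConjecture.Cruxes.H413.F0P3cStCharTSPrincipalSeriesUnitary

end
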